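import Summits.Ventures.PercRepro.C041RcPortRecolour

/-!
# THEOREM R on skeletons, the red-connected-attachment family: THE COUNT (p6, gen 24; mine-3, C-041.md §3)

Setting of `C041RcPortRecolour`.  Fix a bare colouring `O`.  `rcSrcSet O` = the sources of the family `𝒮_rc(O)`;
`rcFibre x` = those with pattern `x`.  By the converse dictionary `rcSrc_iff` and the recolouring, the fibres of
two admissible valid patterns have the same size (`card_rcFibre_eq`) and every other fibre is empty
(`rcFibre_eq_empty`), so

  `Σ_{S ∈ rcSrcSet O} (3·[Good_a S] + 3·[Good_b S] − 2) = N · Φ∨ (rcPort O) ≥ 0`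

(`sum_goodDegree_nonneg_rc_of_bare`) by THE LEMMA `phiOr_nonneg` (general form, `C041ZonePortLemma`) — mine-3's
THEOREM R per colouring: «Σ_{S ∈ 𝒮_rc(O)} (3g(S) − 2) ≥ 0 for every O», on every skeleton with an edge between the
terminals, the probe not adjacent to a terminal, `a ≠ b`, `c ≠ a, b` (no multiplicity or loop restriction).
-/

namespace PercRepro

namespace MultiGraph

open Finset ZonePort

variable {V E : Type*} {G : MultiGraph V E}

section Count

variable [Fintype V] [Fintype E] [DecidableEq E] {a b c : V} (hca : c ≠ a) (hcb : c ≠ b)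
  (hc : ∀ e, ¬ G.Joins e c a ∧ ¬ G.Joins e c b) (hne : a ≠ b) (habE : ∃ e, G.Joins e a b) (O : Config E)

open Classical in
/-- The sources of the rc family with bare colouring `O`, as a finite set. -/
noncomputable def rcSrcSet (G : MultiGraph V E) (a b c : V) (O : Config E) : Finset (Config E) :=
  univ.filter fun S : Config E => G.IsRcSrc a b c O S

open Classical in
/-- The fibre of a pattern. -/
noncomputable def rcFibre (x : (G.rcPort a b c O hca hcb hc).Term → Bool) : Finset (Config E) :=
  (G.rcSrcSet a b c O).filter fun S => rcPattern hca hcb hc S = x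

open Classical in
/-- Membership in a fibre. -/
theorem mem_rcFibre {x : (G.rcPort a b c O hca hcb hc).Term → Bool} {S : Config E} :
    S ∈ rcFibre hca hcb hc O x ↔ G.IsRcSrc a b c O S ∧ rcPattern hca hcb hc S = x := by
  unfold rcFibre rcSrcSet
  simp only [mem_filter, mem_univ, true_and]

open Classical in
/-- Membership in a fibre, coerced. -/
theorem coe_rcFibre_mem {x : (G.rcPort a b c O hca hcb hc).Term → Bool} {S : Config E} :
    S ∈ (↑(rcFibre hca hcb hc O x) : Set (Config E)) ↔ G.IsRcSrc a b c O S ∧ rcPattern hca hcb hc S = x := by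
  rw [Finset.mem_coe]
  exact mem_rcFibre hca hcb hc O

include hne habE in
open Classical in
/-- **The fibres of two admissible valid patterns have the same size** (one direction). -/
theorem card_rcFibre_le {x x' : (G.rcPort a b c O hca hcb hc).Term → Bool}
    (hx' : (G.rcPort a b c O hca hcb hc).Adm x' ∧
      ((G.rcPort a b c O hca hcb hc).X₁ x' ∨ (G.rcPort a b c O hca hcb hc).X₂ x')) :
    (rcFibre hca hcb hc O x).card ≤ (rcFibre hca hcb hc O x').card := by
  refine card_le_card_of_injOn (rcRecolour hca hcb hc O x') ?_ ?_
  · intro S hS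
    rw [coe_rcFibre_mem] at hS ⊢
    exact ⟨rcSrc_rcRecolour hca hcb hc hne habE hS.1 hx'.1 hx'.2, rcPattern_rcRecolour hca hcb hc x' S⟩
  · intro S₁ hS₁ S₂ hS₂ heq
    rw [coe_rcFibre_mem] at hS₁ hS₂
    have h := congrArg (rcRecolour hca hcb hc O x) heq
    rw [rcRecolour_rcRecolour hca hcb hc x x' S₁, rcRecolour_rcRecolour hca hcb hc x x' S₂] at h
    have h1 : rcRecolour hca hcb hc O x S₁ = S₁ := by
      rw [← hS₁.2]
      exact rcRecolour_self hca hcb hc S₁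
    have h2 : rcRecolour hca hcb hc O x S₂ = S₂ := by
      rw [← hS₂.2]
      exact rcRecolour_self hca hcb hc S₂
    rw [h1, h2] at h
    exact h

include hne habE in
open Classical in
/-- **The fibres of two admissible valid patterns have the same size.** -/
theorem card_rcFibre_eq {x x' : (G.rcPort a b c O hca hcb hc).Term → Bool}
    (hx : (G.rcPort a b c O hca hcb hc).Adm x ∧
      ((G.rcPort a b c O hca hcb hc).X₁ x ∨ (G.rcPort a b c O hca hcb hc).X₂ x))
    (hx' : (G.rcPort a b c O hca hcb hc).Adm x' ∧
      ((G.rcPort a b c O hca hcb hc).X₁ x' ∨ (G.rcPort a b c O hca hcb hc).X₂ x')) :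
    (rcFibre hca hcb hc O x).card = (rcFibre hca hcb hc O x').card :=
  le_antisymm (card_rcFibre_le hca hcb hc hne habE O hx') (card_rcFibre_le hca hcb hc hne habE O hx)

include hne habE in
open Classical in
/-- The fibre of a pattern that is not admissible and valid is empty. -/
theorem rcFibre_eq_empty {x : (G.rcPort a b c O hca hcb hc).Term → Bool}
    (hx : ¬ ((G.rcPort a b c O hca hcb hc).Adm x ∧
      ((G.rcPort a b c O hca hcb hc).X₁ x ∨ (G.rcPort a b c O hca hcb hc).X₂ x))) :
    rcFibre hca hcb hc O x = ∅ := by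
  rw [Finset.eq_empty_iff_forall_notMem]
  intro S hS
  rw [mem_rcFibre] at hS
  apply hx
  rw [← hS.2]
  exact adm_valid_of_rcSrc hca hcb hc hne habE hS.1

include hca hcb hc hne habE in
open Classical in
/-- **THE COUNT — mine-3's THEOREM R per colouring** (C-041.md §3): on every skeleton with an edge between the
terminals, the probe not adjacent to a terminal, `c ≠ a, b` and `a ≠ b`, for every bare colouring `O`,
`0 ≤ Σ_{S ∈ 𝒮_rc(O)} (3·[Good_a S] + 3·[Good_b S] − 2)` — from THE LEMMA `phiOr_nonneg` in general form. -/
theorem sum_goodDegree_nonneg_rc_of_bare :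
    0 ≤ ∑ S ∈ G.rcSrcSet a b c O,
      ((if G.WalkAvoiding S (G.cluster Sᶜ a) c b then (3 : ℤ) else 0) +
        (if G.WalkAvoiding S (G.cluster Sᶜ b) c a then 3 else 0) - 2) := by
  set P := G.rcPort a b c O hca hcb hc with hP
  -- the weights are the pattern weights
  have hw : ∀ S ∈ G.rcSrcSet a b c O,
      ((if G.WalkAvoiding S (G.cluster Sᶜ a) c b then (3 : ℤ) else 0) +
        (if G.WalkAvoiding S (G.cluster Sᶜ b) c a then 3 else 0) - 2) = P.weight (rcPattern hca hcb hc S) := by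
    intro S hS
    unfold rcSrcSet at hS
    rw [mem_filter] at hS
    exact (weight_of_rcSrc hca hcb hc hne hS.2).symm
  rw [Finset.sum_congr rfl hw, ← Finset.sum_fiberwise (G.rcSrcSet a b c O) (rcPattern hca hcb hc)]
  -- each fibre contributes its size times the pattern weight
  have hfib : ∀ x : P.Term → Bool,
      ∑ S ∈ (G.rcSrcSet a b c O).filter (fun S => rcPattern hca hcb hc S = x), P.weight (rcPattern hca hcb hc S) =
        (rcFibre hca hcb hc O x).card • P.weight x := by
    intro x
    rw [← Finset.sum_const]
    apply Finset.sum_congr rfl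
    intro S hS
    rw [mem_filter] at hS
    rw [hS.2]
  rw [Finset.sum_congr rfl (fun x _ => by convert hfib x using 2)]
  by_cases hex : ∃ x₀ : P.Term → Bool, P.Adm x₀ ∧ (P.X₁ x₀ ∨ P.X₂ x₀)
  · obtain ⟨x₀, hx₀⟩ := hex
    -- every fibre has the size of `rcFibre x₀` on the admissible valid patterns, and is empty elsewhere
    have hcard : ∀ x : P.Term → Bool, (rcFibre hca hcb hc O x).card • P.weight x =
        ((rcFibre hca hcb hc O x₀).card : ℤ) * (if P.Adm x ∧ (P.X₁ x ∨ P.X₂ x) then P.weight x else 0) := by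
      intro x
      by_cases hx : P.Adm x ∧ (P.X₁ x ∨ P.X₂ x)
      · rw [if_pos hx, card_rcFibre_eq hca hcb hc hne habE O hx hx₀, nsmul_eq_mul]
      · rw [if_neg hx, rcFibre_eq_empty hca hcb hc hne habE O hx, card_empty, zero_smul, mul_zero]
    simp only [hcard]
    rw [← Finset.mul_sum]
    apply mul_nonneg (Nat.cast_nonneg _)
    exact Problem.phiOr_nonneg P (rcPort_zonesReached hca hcb hc)
  · -- no admissible valid pattern: every fibre is empty
    apply Finset.sum_nonneg
    intro x _
    have hx : ¬ (P.Adm x ∧ (P.X₁ x ∨ P.X₂ x)) := fun h => hex ⟨x, h⟩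
    rw [rcFibre_eq_empty hca hcb hc hne habE O hx, card_empty, zero_smul]

end Count

end MultiGraph

end PercRepro
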